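import Literature.NumberTheory.EllipticCurves.PadicSigmaSqVariableChangeProofs
import Literature.NumberTheory.EllipticCurves.PadicSigmaSqTwistTransportProofs
import Literature.NumberTheory.EllipticCurves.FormalInvXExpansionProofs
import Literature.NumberTheory.EllipticCurves.CanonicalPAdicHeightThetaProofs
import HarnessLib

/-!
# The `x⁻¹`-expansion `𝔖_p` of the squared sigma function under a `p`-integral change of variables
# WITH TRANSLATION `r` (proofs only)

Topic `Literature/NumberTheory/EllipticCurves` (trunk T-NT-EC). Pure proof file (no definition, no named fact,
no `sorry`), sequel of `PadicSigmaSqVariableChangeProofs.lean` (`Σ_p(V) = u⁻²·Σ_p(vc • V) ∘ θ` along a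
`p`-integral change of variables `vc = (u, r, s, t)`) and of `PadicSigmaSqTwistTransportProofs.lean` §1 (the
`x⁻¹`-parameter under a change of variables with `r = 0`). Width seat `bsd-line-cf2-p1-w8` (g30) of the cell
`bsd-print-cf2`, in support of stmt-BirchSwinnertonDyer-20368 (road (C) `disegni-pair-two`: MODEL-INDEPENDENCE of
the canonical minus-twist `2`-adic height `log_p den x′ − log_p 𝔖_p(1/x′)` that the research stub (Δ1)
`stub_law_descent_two` quantifies over ALL globally minimal models `V` of `49a1^{(d′)}`). BSD is not proved by
any of this.

## Contents

* §1 (any commutative ring) **`1/x′(θ(z)) · (1 − r/x(z)) = u²/x(z)`** for `vc = (u, r, s, t)`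
  (`formalInvX_variableChange_subst_mul_one_sub`; the tree had the case `r = 0`,
  `formalInvX_variableChange_subst`), i.e. `1/x′ ∘ θ = M_vc(1/x)` with the Möbius series
  `M_vc(w) = u²w/(1 − rw)` (`formalInvX_variableChange_subst_eq_subst`); hence `x⁻¹`-expansions transport:
  `S′(1/x′) = Σ′ ⇒ (a·S′ ∘ M_vc)(1/x) = a·Σ′ ∘ θ` (`IsInvXExpansion.variableChange_subst`).
* §2 (`ℚ_p`) **`Σ_p(V) = u⁻²·Σ_p(vc • V) ∘ θ`** from the uniqueness hypothesis «`log_V` has unbounded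
  denominators» (`padicSigmaSq_eq_of_variableChange_of_unbounded_formalLog`; the tree's
  `padicSigmaSq_eq_of_variableChange_two` is the case `p = 2`, `a₁ ∈ ℤ₂ˣ`).
* §3 (`ℚ`-curves) **`𝔖_p(V) = u⁻²·𝔖_p(D • V) ∘ M_D`** for an `ℚ`-isomorphism `D` that is `p`-integral
  (`padicSigmaSqInvX_eq_subst_of_variableChange`), and its VALUE form
  `𝔖_p(V)(w) = u⁻²·𝔖_p(D • V)(u²w/(1 − rw))` for `‖w‖_p < 1` (`padicSigmaSqInvXEval_eq_of_variableChange`):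
  the sigma-squared local term `𝔖_p(1/x(P))` is a function of the POINT, not of the model
  (`x′ = u⁻²(x − r)` ⇒ `1/x′ = u²(1/x)/(1 − r/x)`).

## Sources

* B. Mazur, J. Tate, *The `p`-adic sigma function*, Duke Math. J. 62 (1991), §3 (dependence of `σ_{(E,ω)}` on
  the model: `σ_{(E,λω)} = λσ_{(E,ω)}`), Thm. 3.1. [MazurTate1991]
* B. Mazur, W. Stein, J. Tate, Doc. Math. Extra Vol. Coates (2006), §1 eq. (1.1), Thm. 1.3. [MazurSteinTate2006]
* J. H. Silverman, Math. Ann. 332 (2005), §5 Rem. 2 (`σ²` is the well-defined object at `p = 2`).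
  [Silverman2005DivPoly]
* J. H. Silverman, *The Arithmetic of Elliptic Curves*, 2nd ed. (2009), III.1 Table 3.1 (`x = u²x′ + r`),
  IV.1 (`z = −x/y`, `x = z/w`). [SilvermanAEC2009]
-/

noncomputable section

open PowerSeries Literature.NumberTheory.EllipticCurves

namespace WeierstrassCurve

/-! ### §1 `1/x(z)` under a change of variables with translation -/

section Ring

variable {R : Type*} [CommRing R] (W : WeierstrassCurve R) (vc : VariableChange R)

/-- **`1/x′(θ(z)) · (1 − r·(1/x(z))) = u²·(1/x(z))`** for a change of variables `vc = (u, r, s, t)` (`x′ = u⁻²(x − r)`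
read through the isomorphism `θ` of formal groups): from the tree's `x′(θ)z′²·z² = u⁻²θ²(xz² − rz²)`,
`(1/x)·(xz²) = z²` and `(1/x′)(θ)·x′(θ)z′² = θ²`, cancelling the units `xz²` and `x′(θ)z′²`.
[Silverman AEC III.1 Table 3.1, IV.1] [cite: SilvermanAEC2009, IV.1.1] -/
theorem formalInvX_variableChange_subst_mul_one_sub :
    (vc • W).formalInvX.subst (W.formalVariableChange vc) * (1 - C vc.r * W.formalInvX) =
      C ((vc.u : R) ^ 2) * W.formalInvX := by
  have hθs := W.hasSubst_formalVariableChange vc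
  have hθ0 := W.constantCoeff_formalVariableChange vc
  set θ := W.formalVariableChange vc with hθdef
  have hX := W.formalXMulSq_variableChange_subst_mul_X_sq vc
  have hT1 : constantCoeff ((vc • W).formalXMulSq.subst θ) = 1 := by
    rw [Literature.RingTheory.FormalGroups.constantCoeff_subst_of_constantCoeff_eq_zero hθ0,
      constantCoeff_formalXMulSq]
  have hTu : IsUnit ((vc • W).formalXMulSq.subst θ) := by
    rw [PowerSeries.isUnit_iff_constantCoeff, hT1]; exact isUnit_one
  have hSu : IsUnit W.formalXMulSq := by
    rw [PowerSeries.isUnit_iff_constantCoeff, constantCoeff_formalXMulSq]; exact isUnit_one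
  have h1 : (vc • W).formalInvX.subst θ * (vc • W).formalXMulSq.subst θ = θ ^ 2 := by
    rw [← subst_mul hθs, formalInvX_mul_formalXMulSq, subst_pow hθs, PowerSeries.subst_X hθs]
  have hu : (C ((vc.u : R) ^ 2) : R⟦X⟧) * C ((vc.u⁻¹ : Rˣ) : R) ^ 2 = 1 := by
    rw [← map_pow, ← map_mul, ← mul_pow, Units.mul_inv, one_pow, map_one]
  have h3 := W.formalInvX_mul_formalXMulSq
  -- `x′(θ)z′² · (1/x) · (xz²) = u⁻²θ²(1 − r/x) · (xz²)`
  have h4 : (vc • W).formalXMulSq.subst θ * W.formalInvX * W.formalXMulSq =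
      C ((vc.u⁻¹ : Rˣ) : R) ^ 2 * θ ^ 2 * (1 - C vc.r * W.formalInvX) * W.formalXMulSq :=
    calc (vc • W).formalXMulSq.subst θ * W.formalInvX * W.formalXMulSq
        = (vc • W).formalXMulSq.subst θ * X ^ 2 := by rw [mul_assoc, h3]
      _ = C ((vc.u⁻¹ : Rˣ) : R) ^ 2 * θ ^ 2 * (W.formalXMulSq - C vc.r * X ^ 2) := hX
      _ = C ((vc.u⁻¹ : Rˣ) : R) ^ 2 * θ ^ 2 * (1 - C vc.r * W.formalInvX) * W.formalXMulSq := by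
          rw [← h3]; ring
  have h5 : (vc • W).formalXMulSq.subst θ * W.formalInvX =
      C ((vc.u⁻¹ : Rˣ) : R) ^ 2 * θ ^ 2 * (1 - C vc.r * W.formalInvX) := hSu.mul_right_cancel h4
  have h6 : (vc • W).formalXMulSq.subst θ * (C ((vc.u : R) ^ 2) * W.formalInvX) =
      (vc • W).formalXMulSq.subst θ *
        ((vc • W).formalInvX.subst θ * (1 - C vc.r * W.formalInvX)) :=
    calc (vc • W).formalXMulSq.subst θ * (C ((vc.u : R) ^ 2) * W.formalInvX)
        = C ((vc.u : R) ^ 2) * ((vc • W).formalXMulSq.subst θ * W.formalInvX) := by ring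
      _ = C ((vc.u : R) ^ 2) * C ((vc.u⁻¹ : Rˣ) : R) ^ 2 * θ ^ 2 * (1 - C vc.r * W.formalInvX) := by
          rw [h5]; ring
      _ = θ ^ 2 * (1 - C vc.r * W.formalInvX) := by rw [hu, one_mul]
      _ = (vc • W).formalXMulSq.subst θ *
            ((vc • W).formalInvX.subst θ * (1 - C vc.r * W.formalInvX)) := by rw [← h1]; ring
  exact (hTu.mul_left_cancel h6).symm

/-- The Möbius series `M_vc(w) = u²w/(1 − rw)` has zero constant term (private plumbing). [folklore] -/
private theorem constantCoeff_moebius_variableChange :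
    constantCoeff (C ((vc.u : R) ^ 2) * X * invOfUnit (1 - C vc.r * X) 1 : R⟦X⟧) = 0 := by
  simp

/-- `M_vc` may be substituted into power series (zero constant term). [folklore] -/
private theorem hasSubst_moebius_variableChange :
    HasSubst (C ((vc.u : R) ^ 2) * X * invOfUnit (1 - C vc.r * X) 1 : R⟦X⟧) :=
  HasSubst.of_constantCoeff_zero' (constantCoeff_moebius_variableChange vc)

/-- `(1 − rX) · (1 − rX)⁻¹ = 1` (the constant term of `1 − rX` is the unit `1`). [folklore] -/
private theorem one_sub_C_mul_X_mul_invOfUnit :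
    (1 - C vc.r * X : R⟦X⟧) * invOfUnit (1 - C vc.r * X) 1 = 1 :=
  mul_invOfUnit _ 1 (by simp)

/-- **`1/x′ ∘ θ = M_vc(1/x)`** with `M_vc(w) = u²w/(1 − rw)`: the `x⁻¹`-parameter of `vc • W`, read through the
isomorphism of formal groups, is the Möbius transform `u²w/(1 − rw)` of the `x⁻¹`-parameter `w` of `W`
(`x′ = u⁻²(x − r)` ⇒ `1/x′ = u²(1/x)/(1 − r/x)`). [Silverman AEC III.1 Table 3.1, IV.1] [cite: SilvermanAEC2009, IV.1.1] -/
theorem formalInvX_variableChange_subst_eq_subst :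
    (vc • W).formalInvX.subst (W.formalVariableChange vc) =
      (C ((vc.u : R) ^ 2) * X * invOfUnit (1 - C vc.r * X) 1 : R⟦X⟧).subst W.formalInvX := by
  have hw := W.hasSubst_formalInvX
  -- the unit `1 − r/x`
  have hDu : IsUnit (1 - C vc.r * W.formalInvX : R⟦X⟧) := by
    rw [PowerSeries.isUnit_iff_constantCoeff]
    simp [constantCoeff_formalInvX]
  have hM : (C ((vc.u : R) ^ 2) * X * invOfUnit (1 - C vc.r * X) 1 : R⟦X⟧).subst W.formalInvX *
      (1 - C vc.r * W.formalInvX) = C ((vc.u : R) ^ 2) * W.formalInvX := by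
    have hone : (1 : R⟦X⟧).subst W.formalInvX = 1 := by rw [← coe_substAlgHom hw, map_one]
    have hinv : (invOfUnit (1 - C vc.r * X) 1 : R⟦X⟧).subst W.formalInvX * (1 - C vc.r * W.formalInvX) = 1 := by
      have h := congrArg (PowerSeries.subst W.formalInvX) (one_sub_C_mul_X_mul_invOfUnit vc)
      rw [subst_mul hw, subst_sub hw, subst_mul hw, PowerSeries.subst_C, PowerSeries.subst_X hw, hone] at h
      rw [mul_comm]; exact h
    rw [subst_mul hw, subst_mul hw, PowerSeries.subst_C, PowerSeries.subst_X hw, mul_assoc, hinv, mul_one]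
    rfl
  exact hDu.mul_right_cancel ((W.formalInvX_variableChange_subst_mul_one_sub vc).trans hM.symm)

variable {W vc} in
/-- **`x⁻¹`-expansions transport along a change of variables**: if `S′(1/x′) = Σ′` on `vc • W`, then
`(a·S′ ∘ M_vc)(1/x) = a·(Σ′ ∘ θ)` on `W`, for every constant `a` (substitution is associative and
`1/x′ ∘ θ = M_vc ∘ 1/x`). With `a = u⁻²` this carries the `x⁻¹`-expansion of `Σ(vc • W)` to that of
`u⁻²Σ(vc • W) ∘ θ = Σ(W)` (Mazur–Tate functoriality). [cite: MazurTate1991, Thm. 3.1] [cite: SilvermanAEC2009, IV.1.1] -/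
theorem IsInvXExpansion.variableChange_subst {Sq' S' : R⟦X⟧} (h : (vc • W).IsInvXExpansion Sq' S') (a : R) :
    W.IsInvXExpansion (C a * Sq'.subst (W.formalVariableChange vc))
      (C a * S'.subst (C ((vc.u : R) ^ 2) * X * invOfUnit (1 - C vc.r * X) 1 : R⟦X⟧)) := by
  have hw := W.hasSubst_formalInvX
  have hw' := (vc • W).hasSubst_formalInvX
  have hθs := W.hasSubst_formalVariableChange vc
  have hMs := hasSubst_moebius_variableChange vc
  have hS' : S'.subst (vc • W).formalInvX = Sq' := h
  show (C a * S'.subst _).subst W.formalInvX = _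
  rw [subst_mul hw, PowerSeries.subst_C, subst_comp_subst_apply hMs hw,
    ← W.formalInvX_variableChange_subst_eq_subst vc, ← subst_comp_subst_apply hw' hθs, hS']
  rfl

end Ring

/-! ### §2 Over `ℚ_p`: `Σ_p(V) = u⁻²·Σ_p(vc • V) ∘ θ` from unbounded denominators of `log_V` -/

section Padic

variable {p : ℕ} [Fact p.Prime] (V : WeierstrassCurve ℚ_[p]) (vc : VariableChange ℚ_[p])

variable {V vc} in
/-- **`Σ_p` and `c` of a `p`-integral `V/ℚ_p` whose formal logarithm has unbounded denominators, from ANY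
sigma-squared pair of a `ℤ_p`-isomorphic model `vc • V`**: `padicSigmaSq V = u⁻²·Σ(vc • V) ∘ θ` and
`padicSigmaSqConst V = u²·c(vc • V) − r` (transport `IsMazurTateSigmaSqPair.of_variableChange` + uniqueness
`IsMazurTateSigmaSqPair.unique_of_unbounded_formalLog`). The tree's `padicSigmaSq_eq_of_variableChange_two` is the
case `p = 2`, `a₁ ∈ ℤ₂ˣ`. [Mazur–Tate 1991, §3 and Thm. 3.1] [cite: MazurTate1991, Thm. 3.1]
[cite: Silverman2005DivPoly, §5 Rem. 2] -/
theorem padicSigmaSq_eq_of_variableChange_of_unbounded_formalLog [V.IsIntegral ℤ_[p]]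
    (hlog : ∀ N : ℕ, ∃ m, (p : ℝ) ^ N < ‖coeff m V.formalLog‖)
    (hu : ‖(vc.u : ℚ_[p])‖ = 1) (hr : ‖vc.r‖ ≤ 1) (hs : ‖vc.s‖ ≤ 1) (ht : ‖vc.t‖ ≤ 1)
    (hex : ∃ Sq' : ℚ_[p]⟦X⟧, ∃ c', (vc • V).IsMazurTateSigmaSqPair Sq' c') :
    V.padicSigmaSq =
        C ((vc.u⁻¹ : ℚ_[p]ˣ) : ℚ_[p]) ^ 2 * (vc • V).padicSigmaSq.subst (V.formalVariableChange vc) ∧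
      V.padicSigmaSqConst = (vc.u : ℚ_[p]) ^ 2 * (vc • V).padicSigmaSqConst - vc.r := by
  have h' := isMazurTateSigmaSqPair_padicSigmaSq (Or.inr hex)
  have hV := h'.of_variableChange hu hr hs ht
  have hpad := isMazurTateSigmaSqPair_padicSigmaSq (Or.inr ⟨_, _, hV⟩)
  exact hpad.unique_of_unbounded_formalLog hlog hV

end Padic

/-! ### §3 `ℚ`-curves: `𝔖_p(V) = u⁻²·𝔖_p(D • V) ∘ M_D`, as series and as values -/

section Rat

variable (V : WeierstrassCurve ℚ) (D : VariableChange ℚ) (p : ℕ) [Fact p.Prime]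

/-- Base change commutes with changes of variables: `(D • V) ⊗ ℚ_p = D_p • (V ⊗ ℚ_p)` (Mathlib
`map_variableChange`; restated in the shape used below). [folklore] -/
private theorem baseChange_padic_smul :
    (D • V).baseChange ℚ_[p] = D.map (algebraMap ℚ ℚ_[p]) • V.baseChange ℚ_[p] := by
  rw [WeierstrassCurve.baseChange, WeierstrassCurve.baseChange, map_variableChange]

variable {V D p} in
/-- **MODEL TRANSPORT OF `𝔖_p` (series form).** Let `V/ℚ` be `ℤ`-integral with `log_{V ⊗ ℚ_p}` of unbounded
denominators, `D = (u, r, s, t)` a change of variables over `ℚ` that is `p`-integral (`u ∈ ℤ_pˣ`, `r, s, t ∈ ℤ_p`),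
and suppose `(D • V) ⊗ ℚ_p` carries a sigma-squared pair. Then `𝔖_p(V) = u⁻²·𝔖_p(D • V) ∘ M_D` with
`M_D(w) = u²w/(1 − rw)`: by §2 `Σ_p(V) = u⁻²Σ_p(D • V) ∘ θ`, by §1 the right-hand side is an `x⁻¹`-expansion of
it, and `x⁻¹`-expansions are unique (`eq_padicSigmaSqInvX_of_isInvXExpansion`). [Mazur–Tate 1991, §3;
Silverman 2005, §5 Rem. 2] [cite: MazurTate1991, Thm. 3.1] [cite: Silverman2005DivPoly, §5 Rem. 2] -/
theorem padicSigmaSqInvX_eq_subst_of_variableChange [V.IsIntegral ℤ]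
    (hlog : ∀ N : ℕ, ∃ m, (p : ℝ) ^ N < ‖coeff m (V.baseChange ℚ_[p]).formalLog‖)
    (hu : ‖((D.map (algebraMap ℚ ℚ_[p])).u : ℚ_[p])‖ = 1) (hr : ‖(D.map (algebraMap ℚ ℚ_[p])).r‖ ≤ 1)
    (hs : ‖(D.map (algebraMap ℚ ℚ_[p])).s‖ ≤ 1) (ht : ‖(D.map (algebraMap ℚ ℚ_[p])).t‖ ≤ 1)
    (hex : ∃ Sq : ℚ_[p]⟦X⟧, ∃ c, ((D • V).baseChange ℚ_[p]).IsMazurTateSigmaSqPair Sq c) :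
    V.padicSigmaSqInvX p =
      (C (((D.map (algebraMap ℚ ℚ_[p])).u⁻¹ : ℚ_[p]ˣ) : ℚ_[p]) ^ 2 * (D • V).padicSigmaSqInvX p).subst
        (C (((D.map (algebraMap ℚ ℚ_[p])).u : ℚ_[p]) ^ 2) * X *
          invOfUnit (1 - C (D.map (algebraMap ℚ ℚ_[p])).r * X) 1 : ℚ_[p]⟦X⟧) := by
  set Dp := D.map (algebraMap ℚ ℚ_[p]) with hDp
  have hbc := V.baseChange_padic_smul D p
  -- the `x⁻¹`-expansion of `Σ_p(D • V)`
  have h𝔖' := isInvXExpansion_padicSigmaSqInvX_of_exists_pair (V := D • V) (p := p) (Or.inr hex)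
  rw [hbc] at h𝔖' hex
  -- §2: `Σ_p(V) = u⁻² Σ_p(D • V) ∘ θ`
  have hSig := (padicSigmaSq_eq_of_variableChange_of_unbounded_formalLog hlog hu hr hs ht hex).1
  -- §1: `u⁻²·𝔖_p(D • V) ∘ M_D` is an `x⁻¹`-expansion of `u⁻² Σ_p(D • V) ∘ θ = Σ_p(V)`
  have hexp := h𝔖'.variableChange_subst (((Dp.u⁻¹ : ℚ_[p]ˣ) : ℚ_[p]) ^ 2)
  rw [map_pow, ← hSig] at hexp
  symm
  have hMs := hasSubst_moebius_variableChange Dp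
  rw [subst_mul hMs, subst_pow hMs, PowerSeries.subst_C]
  exact eq_padicSigmaSqInvX_of_isInvXExpansion hexp

variable {V D p} in
/-- **MODEL TRANSPORT OF `𝔖_p` (value form): `𝔖_p(V)(w) = u⁻²·𝔖_p(D • V)(u²w/(1 − rw))` for `‖w‖_p < 1`.**
Evaluation commutes with substitution for integral series (`𝔖_p(D • V) ∈ ℤ_p⟦w⟧` because `Σ_p(D • V)` is integral,
`IsInvXExpansion.isPadicInt`; `M_D ∈ wℤ_p⟦w⟧`), and `M_D(w) = u²w·(1 − rw)⁻¹`. So the sigma-squared local term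
`𝔖_p(1/x(P))` of a point is MODEL-FREE: with `x′ = u⁻²(x − r)` one has `1/x′ = u²(1/x)/(1 − r/x)`.
[Mazur–Stein–Tate 2006, §1 eq. (1.1); Silverman 2005, §5 Rem. 2] [cite: MazurSteinTate2006, §1 eq. (1.1)]
[cite: Silverman2005DivPoly, §5 Rem. 2] -/
theorem padicSigmaSqInvXEval_eq_of_variableChange [V.IsIntegral ℤ]
    (hlog : ∀ N : ℕ, ∃ m, (p : ℝ) ^ N < ‖coeff m (V.baseChange ℚ_[p]).formalLog‖)
    (hu : ‖((D.map (algebraMap ℚ ℚ_[p])).u : ℚ_[p])‖ = 1) (hr : ‖(D.map (algebraMap ℚ ℚ_[p])).r‖ ≤ 1)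
    (hs : ‖(D.map (algebraMap ℚ ℚ_[p])).s‖ ≤ 1) (ht : ‖(D.map (algebraMap ℚ ℚ_[p])).t‖ ≤ 1)
    (hex : ∃ Sq : ℚ_[p]⟦X⟧, ∃ c, ((D • V).baseChange ℚ_[p]).IsMazurTateSigmaSqPair Sq c)
    {w : ℚ_[p]} (hw : ‖w‖ < 1) :
    V.padicSigmaSqInvXEval p w =
      (((D.map (algebraMap ℚ ℚ_[p])).u⁻¹ : ℚ_[p]ˣ) : ℚ_[p]) ^ 2 *
        (D • V).padicSigmaSqInvXEval p
          ((((D.map (algebraMap ℚ ℚ_[p])).u : ℚ_[p]) ^ 2 * w * (1 - (D.map (algebraMap ℚ ℚ_[p])).r * w)⁻¹)) := by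
  set Dp := D.map (algebraMap ℚ ℚ_[p]) with hDp
  have hbc := V.baseChange_padic_smul D p
  -- integrality of `𝔖_p(D • V)`
  have hpair : ((D • V).baseChange ℚ_[p]).IsMazurTateSigmaSqPair ((D • V).baseChange ℚ_[p]).padicSigmaSq
      ((D • V).baseChange ℚ_[p]).padicSigmaSqConst := isMazurTateSigmaSqPair_padicSigmaSq (Or.inr hex)
  have h𝔖' := isInvXExpansion_padicSigmaSqInvX_of_exists_pair (V := D • V) (p := p) (Or.inr hex)
  haveI : ((D • V).baseChange ℚ_[p]).IsIntegral ℤ_[p] := by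
    rw [hbc]; exact (V.baseChange ℚ_[p]).isIntegral_variableChange Dp hu hr hs ht
  have hint' : IsPadicInt ((D • V).padicSigmaSqInvX p) := h𝔖'.isPadicInt hpair.isPadicInt
  have hui : ‖((Dp.u⁻¹ : ℚ_[p]ˣ) : ℚ_[p])‖ ≤ 1 := by
    rw [Units.val_inv_eq_inv_val, norm_inv, hu, inv_one]
  have hu2 : ‖(Dp.u : ℚ_[p]) ^ 2‖ ≤ 1 := by rw [norm_pow, hu, one_pow]
  have hintS : IsPadicInt (C ((Dp.u⁻¹ : ℚ_[p]ˣ) : ℚ_[p]) ^ 2 * (D • V).padicSigmaSqInvX p) :=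
    ((IsPadicInt.powerSeries_C hui).pow 2).mul hint'
  -- integrality of the Möbius series
  have hden : IsPadicInt (1 - C Dp.r * X : ℚ_[p]⟦X⟧) :=
    IsPadicInt.one.sub ((IsPadicInt.powerSeries_C hr).mul IsPadicInt.powerSeries_X)
  have hinv : IsPadicInt (invOfUnit (1 - C Dp.r * X) 1 : ℚ_[p]⟦X⟧) := hden.invOfUnit_one (by simp)
  have hM : IsPadicInt (C ((Dp.u : ℚ_[p]) ^ 2) * X * invOfUnit (1 - C Dp.r * X) 1 : ℚ_[p]⟦X⟧) :=
    ((IsPadicInt.powerSeries_C hu2).mul IsPadicInt.powerSeries_X).mul hinv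
  have hM0 := constantCoeff_moebius_variableChange Dp
  -- the value of the Möbius series
  have hMval : padicEval (C ((Dp.u : ℚ_[p]) ^ 2) * X * invOfUnit (1 - C Dp.r * X) 1 : ℚ_[p]⟦X⟧) w =
      (Dp.u : ℚ_[p]) ^ 2 * w * (1 - Dp.r * w)⁻¹ := by
    rw [padicEval_mul ((IsPadicInt.powerSeries_C hu2).mul IsPadicInt.powerSeries_X) hinv hw,
      padicEval_mul (IsPadicInt.powerSeries_C hu2) IsPadicInt.powerSeries_X hw, padicEval_C, padicEval_X,
      padicEval_eq_inv_of_mul_eq_one hden hinv (one_sub_C_mul_X_mul_invOfUnit Dp) hw,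
      padicEval_sub IsPadicInt.one ((IsPadicInt.powerSeries_C hr).mul IsPadicInt.powerSeries_X) hw,
      padicEval_one, padicEval_mul (IsPadicInt.powerSeries_C hr) IsPadicInt.powerSeries_X hw, padicEval_C,
      padicEval_X]
  have hm : ‖padicEval (C ((Dp.u : ℚ_[p]) ^ 2) * X * invOfUnit (1 - C Dp.r * X) 1 : ℚ_[p]⟦X⟧) w‖ < 1 :=
    norm_padicEval_lt_one hM hM0 hw
  simp only [padicSigmaSqInvXEval]
  rw [padicSigmaSqInvX_eq_subst_of_variableChange hlog hu hr hs ht hex, padicEval_subst hintS hM hM0 hw,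
    padicEval_mul ((IsPadicInt.powerSeries_C hui).pow 2) hint' hm, padicEval_pow (IsPadicInt.powerSeries_C hui) hm,
    padicEval_C, hMval]

end Rat

end WeierstrassCurve

end
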